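import Literature.NumberTheory.Sieve.PolymathBoundedGapsM50OrbitalCert
import Literature.NumberTheory.Sieve.PolymathBoundedGapsM50OrbitalTables
import HarnessLib

/-!
# `M_{50,1/27} > 4`, kernel-pure — per-pair kernel facts, batch 5/6

Part of the kernel-pure certificate **`M_{50,1/27} > 4`** (parity-ideate cell, ROUND-24 «ALS-ORBITAL», certificate E1 T_3 =
`ALS_r3_cert.json`, sha16 d9bc336f5c4ec53f, λ = 4.000110928047049…, independently verified by the cell's `verify_indep.py` and
reproduced EXACTLY by the Literature mirror `symcert/mirror.py`): a labelled product-radial test function on `(1+ε)·R_50`,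
`ε = 1/27`, base profile `g` (degree 6) and three orbitals `o1, o2, o3` (degree ≤ 19, dyadic, common scale `2^-50`), eleven
excitation multisets `∅, o1, o2, o3, o1o1, o1o2, o1o3, o2o2, o2o3, o3o3, o1o1o1` with integer radial polynomials of degree ≤ 14.
Checked by `SymLCert.sound_tab` (`PolymathSymLCert.lean`): files `PolymathBoundedGapsM50OrbitalCert` (data), `PolymathBoundedGapsM50OrbitalTI1…TI5/TJ1…TJ5` (the
claimed pair numerators), `PolymathBoundedGapsM50OrbitalTables` (dispatch), `PolymathBoundedGapsM50OrbitalPairs1…` (one `decide +kernel` per lower-triangle pair),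
`PolymathBoundedGapsM50OrbitalMain` (assembly: `exists_polymathFunctional_50_gt_four`, standard axioms — no `Lean.ofReduceBool`).

The kernel facts are elaborated SEQUENTIALLY (`Elab.async false`): each `decide +kernel` holds ≈ 10⁸ bytes of cached big integers, so parallel proof elaboration would exceed the per-file memory budget.

## References
* D. H. J. Polymath, *Variants of the Selberg sieve, and bounded intervals containing many primes*, Res. Math. Sci. 1 (2014),
  Art. 12 = arXiv:1407.4897: Theorem 3.13 / eq. (35) (numerical lower bounds for `M_{k,ε}`), §7 (the test-function algebra),
  Theorem 1.4(i) (`H₁ ≤ 246` from `M_{50,ε} > 4`). [Polymath8b2014]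
-/

set_option Elab.async false

namespace Literature.NumberTheory.Sieve.PolymathCert

namespace PolymathM50Orbital

/-- kernel fact: J-side pair (6,1) is valid and has numerator `tJ 6 1`. [cite: Polymath8b2014, Theorem 3.13, eq. (35)] -/
theorem okJ_6_1 : cert.okJ 6 1 (tJ 6 1) = true := by decide +kernel

/-- kernel fact: J-side pair (6,2) is valid and has numerator `tJ 6 2`. [cite: Polymath8b2014, Theorem 3.13, eq. (35)] -/
theorem okJ_6_2 : cert.okJ 6 2 (tJ 6 2) = true := by decide +kernel

/-- kernel fact: J-side pair (6,3) is valid and has numerator `tJ 6 3`. [cite: Polymath8b2014, Theorem 3.13, eq. (35)] -/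
theorem okJ_6_3 : cert.okJ 6 3 (tJ 6 3) = true := by decide +kernel

/-- kernel fact: J-side pair (6,4) is valid and has numerator `tJ 6 4`. [cite: Polymath8b2014, Theorem 3.13, eq. (35)] -/
theorem okJ_6_4 : cert.okJ 6 4 (tJ 6 4) = true := by decide +kernel

/-- kernel fact: J-side pair (6,5) is valid and has numerator `tJ 6 5`. [cite: Polymath8b2014, Theorem 3.13, eq. (35)] -/
theorem okJ_6_5 : cert.okJ 6 5 (tJ 6 5) = true := by decide +kernel

/-- kernel fact: J-side pair (6,6) is valid and has numerator `tJ 6 6`. [cite: Polymath8b2014, Theorem 3.13, eq. (35)] -/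
theorem okJ_6_6 : cert.okJ 6 6 (tJ 6 6) = true := by decide +kernel

/-- kernel fact: J-side pair (7,0) is valid and has numerator `tJ 7 0`. [cite: Polymath8b2014, Theorem 3.13, eq. (35)] -/
theorem okJ_7_0 : cert.okJ 7 0 (tJ 7 0) = true := by decide +kernel

/-- kernel fact: J-side pair (7,1) is valid and has numerator `tJ 7 1`. [cite: Polymath8b2014, Theorem 3.13, eq. (35)] -/
theorem okJ_7_1 : cert.okJ 7 1 (tJ 7 1) = true := by decide +kernel

/-- kernel fact: J-side pair (7,2) is valid and has numerator `tJ 7 2`. [cite: Polymath8b2014, Theorem 3.13, eq. (35)] -/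
theorem okJ_7_2 : cert.okJ 7 2 (tJ 7 2) = true := by decide +kernel

/-- kernel fact: J-side pair (7,3) is valid and has numerator `tJ 7 3`. [cite: Polymath8b2014, Theorem 3.13, eq. (35)] -/
theorem okJ_7_3 : cert.okJ 7 3 (tJ 7 3) = true := by decide +kernel

/-- kernel fact: J-side pair (7,4) is valid and has numerator `tJ 7 4`. [cite: Polymath8b2014, Theorem 3.13, eq. (35)] -/
theorem okJ_7_4 : cert.okJ 7 4 (tJ 7 4) = true := by decide +kernel

/-- kernel fact: J-side pair (7,5) is valid and has numerator `tJ 7 5`. [cite: Polymath8b2014, Theorem 3.13, eq. (35)] -/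
theorem okJ_7_5 : cert.okJ 7 5 (tJ 7 5) = true := by decide +kernel

/-- kernel fact: J-side pair (7,6) is valid and has numerator `tJ 7 6`. [cite: Polymath8b2014, Theorem 3.13, eq. (35)] -/
theorem okJ_7_6 : cert.okJ 7 6 (tJ 7 6) = true := by decide +kernel

/-- kernel fact: J-side pair (7,7) is valid and has numerator `tJ 7 7`. [cite: Polymath8b2014, Theorem 3.13, eq. (35)] -/
theorem okJ_7_7 : cert.okJ 7 7 (tJ 7 7) = true := by decide +kernel

/-- kernel fact: J-side pair (8,0) is valid and has numerator `tJ 8 0`. [cite: Polymath8b2014, Theorem 3.13, eq. (35)] -/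
theorem okJ_8_0 : cert.okJ 8 0 (tJ 8 0) = true := by decide +kernel

/-- kernel fact: J-side pair (8,1) is valid and has numerator `tJ 8 1`. [cite: Polymath8b2014, Theorem 3.13, eq. (35)] -/
theorem okJ_8_1 : cert.okJ 8 1 (tJ 8 1) = true := by decide +kernel

/-- kernel fact: J-side pair (8,2) is valid and has numerator `tJ 8 2`. [cite: Polymath8b2014, Theorem 3.13, eq. (35)] -/
theorem okJ_8_2 : cert.okJ 8 2 (tJ 8 2) = true := by decide +kernel

/-- kernel fact: J-side pair (8,3) is valid and has numerator `tJ 8 3`. [cite: Polymath8b2014, Theorem 3.13, eq. (35)] -/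
theorem okJ_8_3 : cert.okJ 8 3 (tJ 8 3) = true := by decide +kernel

/-- kernel fact: J-side pair (8,4) is valid and has numerator `tJ 8 4`. [cite: Polymath8b2014, Theorem 3.13, eq. (35)] -/
theorem okJ_8_4 : cert.okJ 8 4 (tJ 8 4) = true := by decide +kernel

/-- kernel fact: J-side pair (8,5) is valid and has numerator `tJ 8 5`. [cite: Polymath8b2014, Theorem 3.13, eq. (35)] -/
theorem okJ_8_5 : cert.okJ 8 5 (tJ 8 5) = true := by decide +kernel

/-- kernel fact: J-side pair (8,6) is valid and has numerator `tJ 8 6`. [cite: Polymath8b2014, Theorem 3.13, eq. (35)] -/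
theorem okJ_8_6 : cert.okJ 8 6 (tJ 8 6) = true := by decide +kernel

/-- kernel fact: J-side pair (8,7) is valid and has numerator `tJ 8 7`. [cite: Polymath8b2014, Theorem 3.13, eq. (35)] -/
theorem okJ_8_7 : cert.okJ 8 7 (tJ 8 7) = true := by decide +kernel

end PolymathM50Orbital

end Literature.NumberTheory.Sieve.PolymathCert
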